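import Mathlib.Analysis.SpecialFunctions.Pow.Real
import Mathlib.Algebra.BigOperators.Intervals
import Mathlib.Tactic
import HarnessLib

/-!
# The Legendre integration-ladder TAIL LEMMA of rbsdp SPEC 3.4 (generic `ℓ²` form), proved
(cell `pub-turb` / `turb-bounds`; v2 staging of the refereed one-page lemma R-T, HOME/tribunal/t-lemmas.md passes 1–3;
source of record HOME/code/rbsdp/SPEC.md §1.2, §3.4, §3.6; FW16 = Fantuzzi–Wynn PRE 93 (2016) App. C is the instance `J = N+2`.)

HONEST FRAMING: rigorous bounds for the stated PDE and boundary conditions; no claim about physical turbulence beyond the bound.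
This file is PURE SEQUENCE ALGEBRA over `ℝ` (no polynomials, no integrals, no fluid mechanics). With the Legendre norm
weights `w n = 2/(2n+1) = ‖P_n‖²` and the integration ladder of SPEC 1.2 — if `u' = Σ_j v_j P_j` on `[-1, 1]` and
`u(-1) = 0` then `u = Σ_n u_n P_n` with `u_n = v_{n-1}/(2n-1) - v_{n+1}/(2n+3)` for `n ≥ 1` (`IsLadder v u`, written at
`n = m + 1`) — we prove SPEC 3.4:
* `term_bound` : `w_{m+1} u_{m+1}² ≤ φ_m v_m² + χ_{m+2} v_{m+2}²`, `φ_j = 4/((2j+1)²(2j+3))`, `χ_j = 4/((2j-1)(2j+1)²)`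
  (`(x - y)² ≤ 2x² + 2y²`); `φ_j·[j ≥ J-1] + χ_j·[j ≥ J+1]` is SPEC 3.4's `ω_J(j)`;
* `sum_bound` : the same summed over any window `n = J+1 … J+L`;
* `phi_add_chi_le` : `φ_j + χ_j ≤ λ·w_j` for `j ≥ J+2` with `λ = lam J = 4/((2J+3)(2J+7))` — SPEC 3.4's
  `λ(J', J'+1) = 4/((2J'+1)(2J'+5))` at `J' = J+1` (the ratio `(φ_j + χ_j)/w_j = 4/((2j-1)(2j+3))` decreases in `j`);
* `tail_bound` : **`Σ_{k<L+2} w_{J+1+k} u_{J+1+k}² ≤ φ_J v_J² + φ_{J+1} v_{J+1}² + λ · Σ_{k<L+2} w_{J+2+k} v_{J+2+k}²`** —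
  the form in which SPEC 3.6 uses it (`‖tail of u from J+1‖² ≤` two tracked coefficients of `u'` + `λ ×` the tail of
  `u'` from `J+2`): for row P2-R0 (`N = 4`, `LT = 6`, `LW = 7`) the instances are `J = 4` (`φ_4 = 4/891`, `φ_5 = 4/1573`,
  `λ = 4/165 = λ_T = μ_W`) and `J = 5` (`φ_5 = 4/1573`, `φ_6 = 4/2535`, `λ = 4/221`; `λ_W = (4/165)(4/221) = 16/36465`).
-/

set_option linter.style.longLine false

namespace Summit.NavierStokesRegularity.TurbBounds.LadderTail

open Finset

/-- `w n = 2/(2n+1)`, the squared `L²(-1,1)` norm of the Legendre polynomial `P_n` (rbsdp SPEC §1). -/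
noncomputable def w (n : ℕ) : ℝ := 2 / (2 * (n : ℝ) + 1)

/-- `w n > 0`. -/
theorem w_pos (n : ℕ) : 0 < w n := by
  unfold w; positivity

/-- The Legendre integration ladder (rbsdp SPEC 1.2) between the coefficients `v` of `u'` and `u` of `u` when `u(-1) = 0`:
`u_{m+1} = v_m/(2m+1) - v_{m+2}/(2m+5)` for every `m` (i.e. `u_n = v_{n-1}/(2n-1) - v_{n+1}/(2n+3)`, `n ≥ 1`). -/
def IsLadder (v u : ℕ → ℝ) : Prop :=
  ∀ m : ℕ, u (m + 1) = v m / (2 * (m : ℝ) + 1) - v (m + 2) / (2 * (m : ℝ) + 5)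

/-- First tail weight `φ_j = 4/((2j+1)²(2j+3))` (the `[j ≥ J-1]` summand of SPEC 3.4's `ω_J(j)`). -/
noncomputable def phi (j : ℕ) : ℝ := 4 / ((2 * (j : ℝ) + 1) ^ 2 * (2 * (j : ℝ) + 3))

/-- Second tail weight `χ_j = 4/((2j-1)(2j+1)²)` (the `[j ≥ J+1]` summand of SPEC 3.4's `ω_J(j)`; used only at `j ≥ 2`). -/
noncomputable def chi (j : ℕ) : ℝ := 4 / ((2 * (j : ℝ) - 1) * (2 * (j : ℝ) + 1) ^ 2)

/-- The tail constant `lam J = 4/((2J+3)(2J+7))` = SPEC 3.4's `λ(J+1, J+2)`. -/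
noncomputable def lam (J : ℕ) : ℝ := 4 / ((2 * (J : ℝ) + 3) * (2 * (J : ℝ) + 7))

/-- `φ_j ≥ 0`. -/
theorem phi_nonneg (j : ℕ) : 0 ≤ phi j := by
  unfold phi; positivity

/-- `χ_j ≥ 0` for `j ≥ 1`. -/
theorem chi_nonneg {j : ℕ} (hj : 1 ≤ j) : 0 ≤ chi j := by
  unfold chi
  have : (1 : ℝ) ≤ j := by exact_mod_cast hj
  have h1 : 0 < 2 * (j : ℝ) - 1 := by linarith
  positivity

/-- `lam J > 0`. -/
theorem lam_pos (J : ℕ) : 0 < lam J := by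
  unfold lam; positivity

/-- **Termwise tail bound** (SPEC 3.4, `(x-y)² ≤ 2x² + 2y²`): `w_{m+1} u_{m+1}² ≤ φ_m v_m² + χ_{m+2} v_{m+2}²`. -/
theorem term_bound {v u : ℕ → ℝ} (h : IsLadder v u) (m : ℕ) :
    w (m + 1) * u (m + 1) ^ 2 ≤ phi m * v m ^ 2 + chi (m + 2) * v (m + 2) ^ 2 := by
  rw [h m]
  set x := v m
  set y := v (m + 2)
  have hm : (0 : ℝ) ≤ m := Nat.cast_nonneg m
  have ha : 0 < 2 * (m : ℝ) + 1 := by linarith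
  have hb : 0 < 2 * (m : ℝ) + 5 := by linarith
  have hc : 0 < 2 * (m : ℝ) + 3 := by linarith
  have key : (x / (2 * (m : ℝ) + 1) - y / (2 * (m : ℝ) + 5)) ^ 2
      ≤ 2 * (x / (2 * (m : ℝ) + 1)) ^ 2 + 2 * (y / (2 * (m : ℝ) + 5)) ^ 2 := by
    nlinarith [sq_nonneg (x / (2 * (m : ℝ) + 1) + y / (2 * (m : ℝ) + 5))]
  have hw : w (m + 1) = 2 / (2 * (m : ℝ) + 3) := by
    unfold w; push_cast; ring
  have e1 : 2 / (2 * (m : ℝ) + 3) * (2 * (x / (2 * (m : ℝ) + 1)) ^ 2) = phi m * x ^ 2 := by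
    unfold phi
    field_simp
    ring
  have e2 : 2 / (2 * (m : ℝ) + 3) * (2 * (y / (2 * (m : ℝ) + 5)) ^ 2) = chi (m + 2) * y ^ 2 := by
    unfold chi
    have e : 2 * ((m + 2 : ℕ) : ℝ) - 1 = 2 * (m : ℝ) + 3 := by push_cast; ring
    have e' : 2 * ((m + 2 : ℕ) : ℝ) + 1 = 2 * (m : ℝ) + 5 := by push_cast; ring
    rw [e, e']
    field_simp
    ring
  rw [hw]
  have hpos : 0 < 2 / (2 * (m : ℝ) + 3) := by positivity
  calc 2 / (2 * (m : ℝ) + 3) * (x / (2 * (m : ℝ) + 1) - y / (2 * (m : ℝ) + 5)) ^ 2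
      ≤ 2 / (2 * (m : ℝ) + 3) * (2 * (x / (2 * (m : ℝ) + 1)) ^ 2 + 2 * (y / (2 * (m : ℝ) + 5)) ^ 2) :=
        mul_le_mul_of_nonneg_left key hpos.le
    _ = phi m * x ^ 2 + chi (m + 2) * y ^ 2 := by rw [mul_add, e1, e2]

/-- The termwise bound summed over the window `n = J+1, …, J+L`. -/
theorem sum_bound {v u : ℕ → ℝ} (h : IsLadder v u) (J L : ℕ) :
    ∑ k ∈ range L, w (J + 1 + k) * u (J + 1 + k) ^ 2
      ≤ ∑ k ∈ range L, phi (J + k) * v (J + k) ^ 2 + ∑ k ∈ range L, chi (J + 2 + k) * v (J + 2 + k) ^ 2 := by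
  rw [← sum_add_distrib]
  refine sum_le_sum fun k _ => ?_
  have e1 : J + 1 + k = (J + k) + 1 := by ring
  have e2 : J + 2 + k = (J + k) + 2 := by ring
  rw [e1, e2]
  exact term_bound h (J + k)

/-- `(φ_j + χ_j)/w_j = 4/((2j-1)(2j+3))` is decreasing, so `φ_j + χ_j ≤ lam J · w_j` for `j ≥ J + 2`
(SPEC 3.4: `λ(J', Jv) = 4/((2Jv-1)(2Jv+3))` for `Jv ≥ J'+1`). -/
theorem phi_add_chi_le (J k : ℕ) : phi (J + 2 + k) + chi (J + 2 + k) ≤ lam J * w (J + 2 + k) := by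
  have hJ : (0 : ℝ) ≤ J := Nat.cast_nonneg J
  have hk : (0 : ℝ) ≤ k := Nat.cast_nonneg k
  have ej : ((J + 2 + k : ℕ) : ℝ) = (J : ℝ) + 2 + k := by push_cast; ring
  set j : ℝ := (J : ℝ) + 2 + k with hj
  have h1 : 0 < 2 * j - 1 := by rw [hj]; linarith
  have h2 : 0 < 2 * j + 1 := by rw [hj]; linarith
  have h3 : 0 < 2 * j + 3 := by rw [hj]; linarith
  have h4 : 0 < 2 * (J : ℝ) + 3 := by linarith
  have h5 : 0 < 2 * (J : ℝ) + 7 := by linarith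
  have e1 : phi (J + 2 + k) + chi (J + 2 + k) = 8 / ((2 * j - 1) * (2 * j + 1) * (2 * j + 3)) := by
    unfold phi chi
    rw [ej]
    field_simp
    ring
  have e2 : lam J * w (J + 2 + k) = 8 / ((2 * (J : ℝ) + 3) * (2 * (J : ℝ) + 7) * (2 * j + 1)) := by
    unfold lam w
    rw [ej]
    field_simp
    ring
  rw [e1, e2]
  refine div_le_div_of_nonneg_left (by norm_num) (by positivity) ?_
  have ha : 2 * (J : ℝ) + 3 ≤ 2 * j - 1 := by rw [hj]; linarith
  have hb : 2 * (J : ℝ) + 7 ≤ 2 * j + 3 := by rw [hj]; linarith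
  calc (2 * (J : ℝ) + 3) * (2 * (J : ℝ) + 7) * (2 * j + 1)
      = ((2 * (J : ℝ) + 3) * (2 * (J : ℝ) + 7)) * (2 * j + 1) := by ring
    _ ≤ ((2 * j - 1) * (2 * j + 3)) * (2 * j + 1) := by
        refine mul_le_mul_of_nonneg_right ?_ h2.le
        exact mul_le_mul ha hb h5.le h1.le
    _ = (2 * j - 1) * (2 * j + 1) * (2 * j + 3) := by ring

/-- **The tail lemma in the form used by SPEC 3.6**: the weighted tail of `u` from index `J+1` is at most the two tracked
terms `φ_J v_J² + φ_{J+1} v_{J+1}²` plus `lam J` times the weighted tail of `v = u'` from index `J+2`. -/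
theorem tail_bound {v u : ℕ → ℝ} (h : IsLadder v u) (J L : ℕ) :
    ∑ k ∈ range (L + 2), w (J + 1 + k) * u (J + 1 + k) ^ 2
      ≤ phi J * v J ^ 2 + phi (J + 1) * v (J + 1) ^ 2
        + lam J * ∑ k ∈ range (L + 2), w (J + 2 + k) * v (J + 2 + k) ^ 2 := by
  have hs := sum_bound h J (L + 2)
  -- peel the first two terms of the `φ` sum
  have hpeel : ∑ k ∈ range (L + 2), phi (J + k) * v (J + k) ^ 2
      = phi J * v J ^ 2 + phi (J + 1) * v (J + 1) ^ 2 + ∑ k ∈ range L, phi (J + 2 + k) * v (J + 2 + k) ^ 2 := by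
    rw [sum_range_succ', sum_range_succ']
    have e3 : ∑ k ∈ range L, phi (J + (k + 1 + 1)) * v (J + (k + 1 + 1)) ^ 2
        = ∑ k ∈ range L, phi (J + 2 + k) * v (J + 2 + k) ^ 2 :=
      sum_congr rfl fun k _ => by rw [show J + (k + 1 + 1) = J + 2 + k by ring]
    rw [e3, show J + (0 + 1) = J + 1 by ring, Nat.add_zero]
    ring
  -- extend the peeled `φ` sum to the longer window (nonnegative terms)
  have hext : ∑ k ∈ range L, phi (J + 2 + k) * v (J + 2 + k) ^ 2
      ≤ ∑ k ∈ range (L + 2), phi (J + 2 + k) * v (J + 2 + k) ^ 2 := by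
    refine sum_le_sum_of_subset_of_nonneg (range_subset_range.mpr (Nat.le_add_right L 2)) fun k _ _ => ?_
    exact mul_nonneg (phi_nonneg _) (sq_nonneg _)
  -- combine `φ + χ ≤ lam · w` termwise on the window from `J+2`
  have hcomb : ∑ k ∈ range (L + 2), phi (J + 2 + k) * v (J + 2 + k) ^ 2
        + ∑ k ∈ range (L + 2), chi (J + 2 + k) * v (J + 2 + k) ^ 2
      ≤ lam J * ∑ k ∈ range (L + 2), w (J + 2 + k) * v (J + 2 + k) ^ 2 := by
    rw [← sum_add_distrib, mul_sum]
    refine sum_le_sum fun k _ => ?_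
    have hle := phi_add_chi_le J k
    have hv : 0 ≤ v (J + 2 + k) ^ 2 := sq_nonneg _
    calc phi (J + 2 + k) * v (J + 2 + k) ^ 2 + chi (J + 2 + k) * v (J + 2 + k) ^ 2
        = (phi (J + 2 + k) + chi (J + 2 + k)) * v (J + 2 + k) ^ 2 := by ring
      _ ≤ (lam J * w (J + 2 + k)) * v (J + 2 + k) ^ 2 := mul_le_mul_of_nonneg_right hle hv
      _ = lam J * (w (J + 2 + k) * v (J + 2 + k) ^ 2) := by ring
  linarith [hs, hpeel, hext, hcomb]

end Summit.NavierStokesRegularity.TurbBounds.LadderTail
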